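import Mathlib
import Summits.QuantumFields.YangMills.Theorems.SmallFieldWideningLargeFieldMassRefinementTailElementaryEnvelope
import Summits.QuantumFields.YangMills.Theorems.SmallFieldWideningLargeFieldMassRefinementTailSeriesTail

/-!
# Route `SmallFieldWidening` — crux r3 `LargeFieldMassRefinementTail` (stmt-QuantumFields-22884), line `birth`: THE ELEMENTARY ENVELOPE of the
# block-averaged large-field tail, file 2 of 3: ONE summable profile on the whole envelope, `AveragedTailAt` from any profile OFF it, and the
# reach of the envelope (support file, instrument row; the stub `stub_avgTailPkg` and the crux stay open)

Width seat `ym-line-sfw-p2-w2` (gen 4), 2026-08-28; sequel of `…ElementaryEnvelope` (file 1: the explicit elementary bound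
`Gibbs_K{¬PlaqSmall θ(K−j) (Ū^{j})} ≤ A₀·(L^j)^8·β_{K−j}^8·exp(−L^j p²/(4((151L²)^j)²))` at every height, and its height-free form
`≤ A₀·β_i^8·p(g_i)²·e^{−p(g_i)/4}` on the envelope `E = {(K, j) : j ≤ K, ((151L²)^j)² ≤ p(g_{K−j})}`, `i = K − j`).  THIS FILE:

* §3 the per-height arithmetic `A₀β_i^8 p(g_i)² e^{−p(g_i)/4} ≤ A·2^{−i}` (`β_i = γ^{−1}L^i`, `p(g_i) ≥ b₀(½ i log L)²` for `p₀ ≥ 2`, `x² ≤ 256e^{x/8}`,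
  completing the square) and **`averagedTail_on_envelope`** (`0 < γ ≤ 1`, `0 < b₀`, `2 ≤ p₀`): ONE profile `q ≥ 0`, `Σ q < ∞`, `Σ_n Σ'_t q(t+n) < ∞`
  (the three clauses of `T3BareTailProfile.AveragedTailAt`) with `Gibbs_K{¬PlaqSmall θ(K−j) (Ū^{j})} ≤ q(K−j)` at EVERY `(K, j) ∈ E` — `K`-, height- and
  volume-uniform;
* §4 **`averagedTailAt_of_offEnvelope`** — `AveragedTailAt F γ b₀ p₀` follows from ANY profile for the heights OFF the envelope (`p(g_{K−j}) <
  ((151L²)^j)²`): the located open content of `stub_avgTailPkg` (and of K2 `HistoryTail`) is EXACTLY the super-logarithmic heights;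
* §5 the reach of `E`: `p(g_i)` is monotone in `i` (`pFun_coupling_mono`) and `≥ ½b₀ i log L` (`linear_le_pFun_coupling`); `E` is monotone in the
  height (`envelope_mono`); every fixed height `j₀` lies in `E` whenever `K − j ≥ i₀(j₀)` (`envelope_eventually` — so §3 contains the bounded-height
  theorem `HistoryTailBoundedHeight.unitScaleTilt_perPlaquette_boundedHeight` for all large `K − j`, with constants that do NOT degrade in `j₀`);
  the logarithmic reading `2j·log(151L²) ≤ log p(g_{K−j}) ⇒ (K, j) ∈ E` (`envelope_of_log_le`), i.e. heights `j ≲ p₀·log(K−j)`.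

HONEST SCOPE.  Elementary (deterministic propagation + finest-height chessboard); nothing of Bałaban's (α) representation; the stub, the crux r3
and route `SmallFieldWidening` stay open/conditional.  No summit is proved (rung R3 record; the YM mass gap is NOT touched).

References: T. Bałaban, CMP **102** (1985) 255–275 [Balaban1985UV3] ((7) p.257, (41) p.266, (71) p.273); CMP **98** (1985) 17–51
[Balaban1985Averaging] (Prop. 1 (51) p.26).
-/

noncomputable section

namespace Summit.QuantumFields.YangMills.Theorems.LargeFieldMassRefinementTailElementaryEnvelope

open MeasureTheory
open scoped BigOperators
open Literature.MathematicalPhysics.QuantumFieldTheory (Plaquette)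
open Literature.MathematicalPhysics.QuantumFieldTheory.Balaban1983to89
open Literature.MathematicalPhysics.QuantumFieldTheory.Balaban1983to89.T3ContinuumYM3Torus
open Literature.MathematicalPhysics.QuantumFieldTheory.Balaban1983to89.T3UnitScaleTilt
open Literature.MathematicalPhysics.QuantumFieldTheory.Balaban1983to89.T3UnitLawDensityEML
open Literature.MathematicalPhysics.QuantumFieldTheory.Balaban1983to89.T3CruxEstimates
open Literature.MathematicalPhysics.QuantumFieldTheory.Balaban1983to89.T3FinestHeightTail
open Literature.MathematicalPhysics.QuantumFieldTheory.Balaban1983to89.T3BareTailProfile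
open Literature.MathematicalPhysics.QuantumFieldTheory.Balaban1983to89.T4PairDerivBridge (dist1_le_two_specialUnitaryGroup)
open Literature.MathematicalPhysics.QuantumFieldTheory.Balaban1983to89.T3UpperLiftSplit (scheme_β_eq)
open Summit.QuantumFields.YangMills.Theorems.HistoryTailBoundedHeight

/-! ## §3 The per-height arithmetic and ONE summable profile on the whole envelope -/

section Profile

/-- `x² ≤ 256·e^{x/8}` for `x ≥ 0` (from `1 + y ≤ e^y` at `y = x/16`, squared). [folklore] -/
theorem sq_le_mul_exp_eighth {x : ℝ} (hx : 0 ≤ x) : x ^ 2 ≤ 256 * Real.exp (x / 8) := by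
  have h1 : x / 16 ≤ Real.exp (x / 16) := by
    have := Real.add_one_le_exp (x / 16)
    linarith
  have h2 : (x / 16) ^ 2 ≤ Real.exp (x / 16) ^ 2 := pow_le_pow_left₀ (by positivity) h1 2
  have h3 : Real.exp (x / 16) ^ 2 = Real.exp (x / 8) := by
    rw [← Real.exp_nat_mul]; congr 1; ring
  rw [h3] at h2
  have h4 : (x / 16) ^ 2 = x ^ 2 / 256 := by ring
  rw [h4, div_le_iff₀ (by norm_num : (0:ℝ) < 256)] at h2
  linarith

/-- `p²·e^{−p/4} ≤ 256·e^{−p/8}` for `p ≥ 0`. [folklore] -/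
theorem sq_mul_exp_neg_quarter_le {p : ℝ} (hp : 0 ≤ p) : p ^ 2 * Real.exp (-(p / 4)) ≤ 256 * Real.exp (-(p / 8)) := by
  have h := sq_le_mul_exp_eighth hp
  have hsplit : Real.exp (-(p / 4)) = Real.exp (-(p / 8)) * Real.exp (-(p / 8)) := by
    rw [← Real.exp_add]; congr 1; ring
  have hback : Real.exp (p / 8) * Real.exp (-(p / 8)) = 1 := by
    rw [← Real.exp_add]; simp
  calc p ^ 2 * Real.exp (-(p / 4)) = p ^ 2 * Real.exp (-(p / 8)) * Real.exp (-(p / 8)) := by rw [hsplit, mul_assoc]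
    _ ≤ (256 * Real.exp (p / 8)) * Real.exp (-(p / 8)) * Real.exp (-(p / 8)) := by gcongr
    _ = 256 * (Real.exp (p / 8) * Real.exp (-(p / 8))) * Real.exp (-(p / 8)) := by ring
    _ = 256 * Real.exp (-(p / 8)) := by rw [hback, mul_one]

/-- **THE PER-HEIGHT ARITHMETIC ON THE ENVELOPE** (`0 < γ ≤ 1`, `0 < b₀`, `2 ≤ p₀`, `A₀ ≥ 0`): at distance `i` from the unit scale,
`A₀·β_i^8·(p(g_i)²e^{−p(g_i)/4}) ≤ A·2^{−i}` with `A = 256·A₀·γ^{−8}·exp(b²/4a)`, `a = b₀ log²L/32`, `b = 8 log L + log 2` — since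
`β_i = γ^{−1}L^i`, `p(g_i) = b₀(1 + ½(i log L − log γ))^{p₀} ≥ b₀(½ i log L)²`, `p²e^{−p/4} ≤ 256e^{−p/8}`, and completing the square.
[cite: Balaban1985UV3, (7) p.257 and (71) p.273] -/
theorem perHeight_envelope_bound (F : T3Family) {γ b₀ p₀ : ℝ} (hγ : 0 < γ) (hγ1 : γ ≤ 1) (hb₀ : 0 < b₀) (hp₀ : 2 ≤ p₀)
    {A₀ : ℝ} (hA₀ : 0 ≤ A₀) (i : ℕ) :
    A₀ * (F.scheme ℰp γ).β i ^ 8 *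
        (B10.pFun b₀ p₀ (Real.sqrt (γ * ((F.L : ℝ)⁻¹) ^ i)) ^ 2 *
          Real.exp (-(B10.pFun b₀ p₀ (Real.sqrt (γ * ((F.L : ℝ)⁻¹) ^ i)) / 4))) ≤
      (256 * A₀ * γ⁻¹ ^ 8 *
          Real.exp ((8 * Real.log F.L + Real.log 2) ^ 2 / (4 * (b₀ * Real.log F.L ^ 2 / 32)))) *
        ((1 : ℝ) / 2) ^ i := by
  -- constants
  have hL1 : (1 : ℝ) < F.L := by exact_mod_cast F.hL.2
  have hL0 : (0 : ℝ) < F.L := one_pos.trans hL1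
  set ℓ : ℝ := Real.log F.L with hℓ
  have hℓ0 : 0 < ℓ := Real.log_pos hL1
  have hlogγ : Real.log γ ≤ 0 := Real.log_nonpos hγ.le hγ1
  set a : ℝ := b₀ * ℓ ^ 2 / 32 with ha
  have ha0 : 0 < a := by positivity
  set b : ℝ := 8 * ℓ + Real.log 2 with hb
  -- the coupling at distance `i`
  set x : ℝ := γ * ((F.L : ℝ)⁻¹) ^ i with hx
  have hLK0 : (0 : ℝ) < (F.L : ℝ) ^ i := pow_pos hL0 i
  have hinvK : ((F.L : ℝ)⁻¹) ^ i = ((F.L : ℝ) ^ i)⁻¹ := by rw [inv_pow]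
  have hx0 : 0 < x := by rw [hx, hinvK]; positivity
  have hxinv : x⁻¹ = γ⁻¹ * (F.L : ℝ) ^ i := by rw [hx, hinvK, mul_inv, inv_inv]
  set g : ℝ := Real.sqrt x with hg
  have hg0 : 0 < g := Real.sqrt_pos.mpr hx0
  have hlogg : Real.log g⁻¹ = (i * ℓ - Real.log γ) / 2 := by
    rw [Real.log_inv, hg, Real.log_sqrt hx0.le, hx, Real.log_mul hγ.ne' (pow_ne_zero _ (inv_ne_zero hL0.ne')),
      Real.log_pow, Real.log_inv]
    ring
  set u : ℝ := 1 + Real.log g⁻¹ with hu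
  have hu1 : 1 ≤ u := by
    rw [hu, hlogg]
    have : 0 ≤ (i : ℝ) * ℓ := by positivity
    linarith
  have hu0 : 0 ≤ u := zero_le_one.trans hu1
  have huK : (i : ℝ) * ℓ / 2 ≤ u := by
    rw [hu, hlogg]; linarith
  -- `p(g_i) ≥ b₀ u² ≥ b₀ (i log L / 2)² ≥ 0`
  set pg : ℝ := B10.pFun b₀ p₀ g with hpg
  have hpF : pg = b₀ * u ^ p₀ := rfl
  have hup : u ^ (2 : ℕ) ≤ u ^ p₀ := by
    rw [← Real.rpow_natCast u 2]
    exact Real.rpow_le_rpow_of_exponent_le hu1 (by exact_mod_cast hp₀)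
  have hpg_ge : b₀ * ((i : ℝ) * ℓ / 2) ^ 2 ≤ pg := by
    rw [hpF]
    calc b₀ * ((i : ℝ) * ℓ / 2) ^ 2 ≤ b₀ * u ^ (2 : ℕ) := by gcongr
      _ ≤ b₀ * u ^ p₀ := by gcongr
  have hpg0 : 0 ≤ pg := le_trans (by positivity) hpg_ge
  -- `p² e^{−p/4} ≤ 256 e^{−p/8} ≤ 256 e^{−a i²}`
  have hsq := sq_mul_exp_neg_quarter_le hpg0
  have hexp : Real.exp (-(pg / 8)) ≤ Real.exp (-(a * (i : ℝ) ^ 2)) := by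
    refine Real.exp_le_exp.mpr (neg_le_neg ?_)
    have : a * (i : ℝ) ^ 2 = b₀ * ((i : ℝ) * ℓ / 2) ^ 2 / 8 := by rw [ha]; ring
    rw [this]
    linarith
  -- the inverse coupling factor `β_i^8 = γ^{−8} (L^i)^8`
  have hβA : (F.scheme ℰp γ).β i ^ 8 = γ⁻¹ ^ 8 * ((F.L : ℝ) ^ i) ^ 8 := by
    rw [scheme_β_eq, ← hx, hxinv, mul_pow]
  -- `(L^i)^8 e^{−a i²} ≤ e^{b²/4a} 2^{−i}`
  have hLpow : ((F.L : ℝ) ^ i) ^ 8 = Real.exp (8 * ((i : ℝ) * ℓ)) := by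
    rw [← pow_mul, hℓ, show (8 : ℝ) * ((i : ℝ) * Real.log F.L) = ((i * 8 : ℕ) : ℝ) * Real.log F.L by
      push_cast; ring, Real.exp_nat_mul, Real.exp_log hL0]
  have hhalf : ((1 : ℝ) / 2) ^ i = Real.exp (-((i : ℝ) * Real.log 2)) := by
    rw [Real.exp_neg, Real.exp_nat_mul, Real.exp_log two_pos, one_div, inv_pow]
  have hgauss : ((F.L : ℝ) ^ i) ^ 8 * Real.exp (-(a * (i : ℝ) ^ 2)) ≤
      Real.exp (b ^ 2 / (4 * a)) * ((1 : ℝ) / 2) ^ i := by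
    rw [hLpow, hhalf, ← Real.exp_add, ← Real.exp_add]
    refine Real.exp_le_exp.mpr ?_
    have hq := LargeFieldMassRefinementTail.quadratic_le_sq_div ha0 b (i : ℝ)
    rw [hb] at hq ⊢
    nlinarith
  -- assemble
  rw [hβA]
  calc A₀ * (γ⁻¹ ^ 8 * ((F.L : ℝ) ^ i) ^ 8) * (pg ^ 2 * Real.exp (-(pg / 4)))
      ≤ A₀ * (γ⁻¹ ^ 8 * ((F.L : ℝ) ^ i) ^ 8) * (256 * Real.exp (-(pg / 8))) := by gcongr
    _ ≤ A₀ * (γ⁻¹ ^ 8 * ((F.L : ℝ) ^ i) ^ 8) * (256 * Real.exp (-(a * (i : ℝ) ^ 2))) := by gcongr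
    _ = (256 * A₀ * γ⁻¹ ^ 8) * (((F.L : ℝ) ^ i) ^ 8 * Real.exp (-(a * (i : ℝ) ^ 2))) := by ring
    _ ≤ (256 * A₀ * γ⁻¹ ^ 8) * (Real.exp (b ^ 2 / (4 * a)) * ((1 : ℝ) / 2) ^ i) := by gcongr
    _ = (256 * A₀ * γ⁻¹ ^ 8 * Real.exp (b ^ 2 / (4 * a))) * ((1 : ℝ) / 2) ^ i := by ring

/-- Shifted tails of the geometric profile `A·2^{−i}` are summable in the shift (the third clause of `AveragedTailAt`). [folklore] -/
theorem summable_shifted_geometric (A : ℝ) : Summable fun n : ℕ => ∑' t : ℕ, A * ((1 : ℝ) / 2) ^ (t + n) := by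
  have heq : (fun n => ∑' t, A * (1 / 2 : ℝ) ^ (t + n)) = fun n => (2 * A) * (1 / 2 : ℝ) ^ n := by
    funext n
    have h1 : (fun t => A * (1 / 2 : ℝ) ^ (t + n)) = fun t => (A * (1 / 2 : ℝ) ^ n) * (1 / 2 : ℝ) ^ t := by
      funext t; rw [pow_add]; ring
    rw [h1, tsum_mul_left, tsum_geometric_two]; ring
  rw [heq]
  exact (summable_geometric_of_lt_one (by norm_num) (by norm_num)).mul_left (2 * A)

/-- **THE BLOCK-AVERAGED LARGE-FIELD TAIL ON THE WHOLE ELEMENTARY ENVELOPE, UNCONDITIONALLY** (`0 < γ ≤ 1`, `0 < b₀`, `2 ≤ p₀`): ONE profile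
`q ≥ 0` with `Σ q < ∞` and `Σ_n Σ'_t q(t+n) < ∞` (the three clauses of `T3BareTailProfile.AveragedTailAt`) such that for EVERY cut-off `K` and
EVERY height `j ≤ K` with `((151L²)^j)² ≤ p(g_{K−j})`,
`Gibbs_K{U : ¬PlaqSmall θ(K−j) (Ū^{j})} ≤ q(K−j)` — `K`-, height- and volume-uniform (`q(i) = A·2^{−i}`, `A` explicit in `L, m, γ, b₀` and the
Haar small-ball constant `c₀` of `SU(2)`).  The envelope reaches every fixed height (§5) and heights growing like `log(K−j)`; the stub
`stub_avgTailPkg` asks for ALL heights and is NOT claimed. [cite: Balaban1985UV3, (7) p.257, (11) p.258 and (71) p.273; Balaban1985Averaging, Prop. 1 (51) p.26] -/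
theorem averagedTail_on_envelope (F : T3Family) {γ b₀ p₀ : ℝ} (hγ : 0 < γ) (hγ1 : γ ≤ 1) (hb₀ : 0 < b₀) (hp₀ : 2 ≤ p₀) :
    ∃ q : ℕ → ℝ, (∀ i, 0 ≤ q i) ∧ Summable q ∧ (Summable fun n => ∑' t, q (t + n)) ∧
      ∀ K j : ℕ, j ≤ K →
        ((151 * (F.L : ℝ) ^ 2) ^ j) ^ 2 ≤ B10.pFun b₀ p₀ (Real.sqrt (γ * ((F.L : ℝ)⁻¹) ^ (K - j))) →
        (gibbsK F ℰp γ K).real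
            {U | ¬ PlaqSmall (θBal F.L γ b₀ p₀ (K - j))
              (Averaging.iter (fun i => BlockAveraging.blockAvg (P := F.P K) (j := i) ℰp) j U)} ≤ q (K - j) := by
  obtain ⟨c₀, hc₀, _, henv⟩ := gibbsK_real_not_plaqSmall_iter_le_of_envelope
  set A₀ : ℝ := 144 * Real.exp 24 * (c₀ ^ 3)⁻¹ * (F.L : ℝ) ^ (3 * F.m) with hA₀
  have hA₀0 : 0 ≤ A₀ := by positivity
  set A : ℝ := 256 * A₀ * γ⁻¹ ^ 8 *
      Real.exp ((8 * Real.log F.L + Real.log 2) ^ 2 / (4 * (b₀ * Real.log F.L ^ 2 / 32))) with hA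
  have hA0 : 0 ≤ A := by positivity
  refine ⟨fun i => A * (1 / 2 : ℝ) ^ i, fun i => by positivity, ?_, summable_shifted_geometric A, fun K j hjK hKj => ?_⟩
  · exact (summable_geometric_of_lt_one (by norm_num) (by norm_num)).mul_left A
  · exact (henv F γ hγ hγ1 b₀ p₀ hb₀.le K j hjK hKj).trans (perHeight_envelope_bound F hγ hγ1 hb₀ hp₀ hA₀0 (K - j))

end Profile

/-! ## §4 `AveragedTailAt` from ANY profile OFF the envelope: the open content of `stub_avgTailPkg` is the super-logarithmic heights -/

section OffEnvelope

/-- **`AveragedTailAt` FROM THE HEIGHTS OFF THE ENVELOPE** (`0 < γ ≤ 1`, `0 < b₀`, `2 ≤ p₀`): if SOME profile `q' ≥ 0` (summable, with summable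
shifted tails) bounds `Gibbs_K{¬PlaqSmall θ(K−j) (Ū^{j})} ≤ q'(K−j)` at every `(K, j)`, `1 ≤ j ≤ K`, with `p(g_{K−j}) < ((151L²)^j)²` — the
SUPER-LOGARITHMIC heights, where the per-cell entropy `∝ L^{3j}` beats the energy `p²` of one large averaged plaquette and Bałaban's
renormalisation-group representation is needed — then `AveragedTailAt F γ b₀ p₀` (profiles add; §3 supplies the envelope).  Kernel certificate that
the located open content of the ONE registered stub of crux r3 (and of K2 `HistoryTail`) is EXACTLY the complement of the elementary envelope.
[cite: Balaban1985UV3, (41) p.266 and (71) p.273] -/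
theorem averagedTailAt_of_offEnvelope (F : T3Family) {γ b₀ p₀ : ℝ} (hγ : 0 < γ) (hγ1 : γ ≤ 1) (hb₀ : 0 < b₀) (hp₀ : 2 ≤ p₀)
    (hoff : ∃ q' : ℕ → ℝ, (∀ i, 0 ≤ q' i) ∧ Summable q' ∧ (Summable fun n => ∑' t, q' (t + n)) ∧
      ∀ K j : ℕ, 1 ≤ j → j ≤ K →
        B10.pFun b₀ p₀ (Real.sqrt (γ * ((F.L : ℝ)⁻¹) ^ (K - j))) < ((151 * (F.L : ℝ) ^ 2) ^ j) ^ 2 →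
        (gibbsK F ℰp γ K).real
            {U | ¬ PlaqSmall (θBal F.L γ b₀ p₀ (K - j))
              (Averaging.iter (fun i => BlockAveraging.blockAvg (P := F.P K) (j := i) ℰp) j U)} ≤ q' (K - j)) :
    AveragedTailAt F γ b₀ p₀ := by
  obtain ⟨q, hq0, hq, hqt, hon⟩ := averagedTail_on_envelope F hγ hγ1 hb₀ hp₀
  obtain ⟨q', hq'0, hq', hq't, hoff⟩ := hoff
  have hshift : ∀ {f : ℕ → ℝ}, Summable f → ∀ n : ℕ, Summable fun t => f (t + n) :=
    fun hf n => (summable_nat_add_iff n).mpr hf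
  refine ⟨fun i => q i + q' i, fun i => add_nonneg (hq0 i) (hq'0 i), hq.add hq', ?_, fun K j hj1 hjK => ?_⟩
  · have heq : (fun n => ∑' t, (q (t + n) + q' (t + n))) = fun n => (∑' t, q (t + n)) + ∑' t, q' (t + n) := by
      funext n
      exact (hshift hq n).tsum_add (hshift hq' n)
    rw [heq]
    exact hqt.add hq't
  · by_cases henv : ((151 * (F.L : ℝ) ^ 2) ^ j) ^ 2 ≤ B10.pFun b₀ p₀ (Real.sqrt (γ * ((F.L : ℝ)⁻¹) ^ (K - j)))
    · exact (hon K j hjK henv).trans (le_add_of_nonneg_right (hq'0 _))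
    · exact (hoff K j hj1 hjK (not_le.mp henv)).trans (le_add_of_nonneg_left (hq0 _))

end OffEnvelope

/-! ## §5 The reach of the envelope: monotone in the height, eventually containing every fixed height, logarithmic reading -/

section Reach

variable (F : T3Family)

/-- `p(g_i)` unfolded at the family's couplings: `p(g_i) = b₀·(1 + ½(i·log L − log γ))^{p₀}` (`γ > 0`). [cite: Balaban1985UV3, (7) p.257] -/
theorem pFun_coupling_eq {γ : ℝ} (hγ : 0 < γ) (b₀ p₀ : ℝ) (i : ℕ) :
    B10.pFun b₀ p₀ (Real.sqrt (γ * ((F.L : ℝ)⁻¹) ^ i)) =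
      b₀ * (1 + ((i : ℝ) * Real.log F.L - Real.log γ) / 2) ^ p₀ := by
  have hL1 : (1 : ℝ) < F.L := by exact_mod_cast F.hL.2
  have hL0 : (0 : ℝ) < F.L := one_pos.trans hL1
  have hinvK : ((F.L : ℝ)⁻¹) ^ i = ((F.L : ℝ) ^ i)⁻¹ := by rw [inv_pow]
  have hx0 : 0 < γ * ((F.L : ℝ)⁻¹) ^ i := by rw [hinvK]; positivity
  have hlogg : Real.log (Real.sqrt (γ * ((F.L : ℝ)⁻¹) ^ i))⁻¹ = ((i : ℝ) * Real.log F.L - Real.log γ) / 2 := by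
    rw [Real.log_inv, Real.log_sqrt hx0.le, Real.log_mul hγ.ne' (pow_ne_zero _ (inv_ne_zero hL0.ne')),
      Real.log_pow, Real.log_inv]
    ring
  unfold B10.pFun
  rw [hlogg]

/-- The base `1 + ½(i log L − log γ)` is at least `1 + ½ i log L ≥ 1` for `0 < γ ≤ 1`. [cite: Balaban1985UV3, (7) p.257] -/
theorem one_add_le_base {γ : ℝ} (hγ : 0 < γ) (hγ1 : γ ≤ 1) (i : ℕ) :
    1 + (i : ℝ) * Real.log F.L / 2 ≤ 1 + ((i : ℝ) * Real.log F.L - Real.log γ) / 2 := by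
  have hlogγ : Real.log γ ≤ 0 := Real.log_nonpos hγ.le hγ1
  linarith

/-- **`p(g_i)` IS MONOTONE IN THE DISTANCE FROM THE UNIT SCALE** (`0 < γ ≤ 1`, `0 ≤ b₀`, `0 ≤ p₀`): `i ≤ i' ⇒ p(g_i) ≤ p(g_{i'})`.
[cite: Balaban1985UV3, (7) p.257] -/
theorem pFun_coupling_mono {γ b₀ p₀ : ℝ} (hγ : 0 < γ) (hγ1 : γ ≤ 1) (hb₀ : 0 ≤ b₀) (hp₀ : 0 ≤ p₀) {i i' : ℕ} (hii' : i ≤ i') :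
    B10.pFun b₀ p₀ (Real.sqrt (γ * ((F.L : ℝ)⁻¹) ^ i)) ≤ B10.pFun b₀ p₀ (Real.sqrt (γ * ((F.L : ℝ)⁻¹) ^ i')) := by
  have hL1 : (1 : ℝ) < F.L := by exact_mod_cast F.hL.2
  have hℓ0 : 0 < Real.log F.L := Real.log_pos hL1
  rw [pFun_coupling_eq F hγ, pFun_coupling_eq F hγ]
  have hbase0 : 0 ≤ 1 + ((i : ℝ) * Real.log F.L - Real.log γ) / 2 := by
    have h := one_add_le_base F hγ hγ1 i
    have : 0 ≤ (i : ℝ) * Real.log F.L := by positivity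
    linarith
  have hle : 1 + ((i : ℝ) * Real.log F.L - Real.log γ) / 2 ≤ 1 + ((i' : ℝ) * Real.log F.L - Real.log γ) / 2 := by
    have : (i : ℝ) * Real.log F.L ≤ (i' : ℝ) * Real.log F.L := by
      gcongr
    linarith
  exact mul_le_mul_of_nonneg_left (Real.rpow_le_rpow hbase0 hle hp₀) hb₀

/-- **A LINEAR LOWER BOUND**: `½ b₀ i log L ≤ p(g_i)` (`0 < γ ≤ 1`, `0 ≤ b₀`, `1 ≤ p₀`). [cite: Balaban1985UV3, (7) p.257] -/
theorem linear_le_pFun_coupling {γ b₀ p₀ : ℝ} (hγ : 0 < γ) (hγ1 : γ ≤ 1) (hb₀ : 0 ≤ b₀) (hp₀ : 1 ≤ p₀) (i : ℕ) :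
    b₀ * ((i : ℝ) * Real.log F.L / 2) ≤ B10.pFun b₀ p₀ (Real.sqrt (γ * ((F.L : ℝ)⁻¹) ^ i)) := by
  have hL1 : (1 : ℝ) < F.L := by exact_mod_cast F.hL.2
  have hℓ0 : 0 < Real.log F.L := Real.log_pos hL1
  rw [pFun_coupling_eq F hγ]
  set u : ℝ := 1 + ((i : ℝ) * Real.log F.L - Real.log γ) / 2 with hu
  have hu1 : 1 ≤ u := by
    have h := one_add_le_base F hγ hγ1 i
    have : 0 ≤ (i : ℝ) * Real.log F.L := by positivity
    rw [hu]; linarith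
  have huK : (i : ℝ) * Real.log F.L / 2 ≤ u := by
    have h := one_add_le_base F hγ hγ1 i
    rw [hu]; linarith
  calc b₀ * ((i : ℝ) * Real.log F.L / 2) ≤ b₀ * u := by gcongr
    _ ≤ b₀ * u ^ p₀ := by gcongr; exact Real.self_le_rpow_of_one_le hu1 hp₀

/-- **THE ENVELOPE IS MONOTONE IN THE HEIGHT**: `(K, j) ∈ E`, `j' ≤ j ≤ K` ⇒ `(K, j') ∈ E` (`0 < γ ≤ 1`, `0 ≤ b₀`, `0 ≤ p₀`). [folklore] -/
theorem envelope_mono {γ b₀ p₀ : ℝ} (hγ : 0 < γ) (hγ1 : γ ≤ 1) (hb₀ : 0 ≤ b₀) (hp₀ : 0 ≤ p₀) {K j j' : ℕ} (hj' : j' ≤ j)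
    (hjK : j ≤ K) (henv : ((151 * (F.L : ℝ) ^ 2) ^ j) ^ 2 ≤ B10.pFun b₀ p₀ (Real.sqrt (γ * ((F.L : ℝ)⁻¹) ^ (K - j)))) :
    ((151 * (F.L : ℝ) ^ 2) ^ j') ^ 2 ≤ B10.pFun b₀ p₀ (Real.sqrt (γ * ((F.L : ℝ)⁻¹) ^ (K - j'))) := by
  have hΛ1 := one_le_lam F
  calc ((151 * (F.L : ℝ) ^ 2) ^ j') ^ 2 ≤ ((151 * (F.L : ℝ) ^ 2) ^ j) ^ 2 :=
        pow_le_pow_left₀ (by positivity) (pow_le_pow_right₀ hΛ1 hj') 2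
    _ ≤ B10.pFun b₀ p₀ (Real.sqrt (γ * ((F.L : ℝ)⁻¹) ^ (K - j))) := henv
    _ ≤ B10.pFun b₀ p₀ (Real.sqrt (γ * ((F.L : ℝ)⁻¹) ^ (K - j'))) :=
        pFun_coupling_mono F hγ hγ1 hb₀ hp₀ (by omega)

/-- **EVERY FIXED HEIGHT IS EVENTUALLY INSIDE THE ENVELOPE** (`0 < γ ≤ 1`, `0 < b₀`, `1 ≤ p₀`): for every `j₀` there is `i₀` with `(K, j) ∈ E`
whenever `j ≤ j₀`, `j ≤ K` and `K − j ≥ i₀` — so `averagedTail_on_envelope` contains the bounded-height theorem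
`HistoryTailBoundedHeight.unitScaleTilt_perPlaquette_boundedHeight` for all large `K − j`, with constants that do NOT degrade in `j₀`, and the top of
the envelope tends to infinity with `K − j`. [folklore] -/
theorem envelope_eventually {γ b₀ p₀ : ℝ} (hγ : 0 < γ) (hγ1 : γ ≤ 1) (hb₀ : 0 < b₀) (hp₀ : 1 ≤ p₀) (j₀ : ℕ) :
    ∃ i₀ : ℕ, ∀ K j : ℕ, j ≤ j₀ → j ≤ K → i₀ ≤ K - j →
      ((151 * (F.L : ℝ) ^ 2) ^ j) ^ 2 ≤ B10.pFun b₀ p₀ (Real.sqrt (γ * ((F.L : ℝ)⁻¹) ^ (K - j))) := by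
  have hL1 : (1 : ℝ) < F.L := by exact_mod_cast F.hL.2
  have hℓ0 : 0 < Real.log F.L := Real.log_pos hL1
  have hΛ1 := one_le_lam F
  set M : ℝ := ((151 * (F.L : ℝ) ^ 2) ^ j₀) ^ 2 with hM
  obtain ⟨i₀, hi₀⟩ := exists_nat_ge (M / (b₀ * (Real.log F.L / 2)))
  refine ⟨i₀, fun K j hj hjK hi => ?_⟩
  have hden : 0 < b₀ * (Real.log F.L / 2) := by positivity
  have hMi : M ≤ b₀ * (((K - j : ℕ) : ℝ) * Real.log F.L / 2) := by
    have h1 : M ≤ (i₀ : ℝ) * (b₀ * (Real.log F.L / 2)) := (div_le_iff₀ hden).mp hi₀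
    have h2 : (i₀ : ℝ) ≤ ((K - j : ℕ) : ℝ) := by exact_mod_cast hi
    calc M ≤ (i₀ : ℝ) * (b₀ * (Real.log F.L / 2)) := h1
      _ ≤ ((K - j : ℕ) : ℝ) * (b₀ * (Real.log F.L / 2)) := by gcongr
      _ = b₀ * (((K - j : ℕ) : ℝ) * Real.log F.L / 2) := by ring
  calc ((151 * (F.L : ℝ) ^ 2) ^ j) ^ 2 ≤ M := pow_le_pow_left₀ (by positivity) (pow_le_pow_right₀ hΛ1 hj) 2
    _ ≤ b₀ * (((K - j : ℕ) : ℝ) * Real.log F.L / 2) := hMi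
    _ ≤ B10.pFun b₀ p₀ (Real.sqrt (γ * ((F.L : ℝ)⁻¹) ^ (K - j))) := linear_le_pFun_coupling F hγ hγ1 hb₀.le hp₀ (K - j)

/-- **THE LOGARITHMIC READING OF THE ENVELOPE** (`0 < γ ≤ 1`, `0 < b₀`): `2j·log(151L²) ≤ log p(g_{K−j}) ⇒ (K, j) ∈ E` — the envelope is the
region of heights `j ≤ log p(g_{K−j}) / (2 log(151L²))`, i.e. `j ≲ p₀·log(K−j)`. [folklore] -/
theorem envelope_of_log_le {γ b₀ p₀ : ℝ} (hγ : 0 < γ) (hγ1 : γ ≤ 1) (hb₀ : 0 < b₀) {K j : ℕ}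
    (hlog : 2 * (j : ℝ) * Real.log (151 * (F.L : ℝ) ^ 2) ≤
      Real.log (B10.pFun b₀ p₀ (Real.sqrt (γ * ((F.L : ℝ)⁻¹) ^ (K - j))))) :
    ((151 * (F.L : ℝ) ^ 2) ^ j) ^ 2 ≤ B10.pFun b₀ p₀ (Real.sqrt (γ * ((F.L : ℝ)⁻¹) ^ (K - j))) := by
  have hΛ0 := lam_pos F
  -- `p > 0`: `p = b₀ u^{p₀}` with `u ≥ 1`
  have hp0 : 0 < B10.pFun b₀ p₀ (Real.sqrt (γ * ((F.L : ℝ)⁻¹) ^ (K - j))) := by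
    rw [pFun_coupling_eq F hγ]
    have hL1 : (1 : ℝ) < F.L := by exact_mod_cast F.hL.2
    have hℓ0 : 0 < Real.log F.L := Real.log_pos hL1
    have h := one_add_le_base F hγ hγ1 (K - j)
    have : 0 ≤ ((K - j : ℕ) : ℝ) * Real.log F.L := by positivity
    have hu : 0 < 1 + (((K - j : ℕ) : ℝ) * Real.log F.L - Real.log γ) / 2 := by linarith
    exact mul_pos hb₀ (Real.rpow_pos_of_pos hu p₀)
  have hlhs : ((151 * (F.L : ℝ) ^ 2) ^ j) ^ 2 = Real.exp (2 * (j : ℝ) * Real.log (151 * (F.L : ℝ) ^ 2)) := by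
    rw [← pow_mul, show 2 * (j : ℝ) * Real.log (151 * (F.L : ℝ) ^ 2) = ((j * 2 : ℕ) : ℝ) * Real.log (151 * (F.L : ℝ) ^ 2) by
      push_cast; ring, Real.exp_nat_mul, Real.exp_log hΛ0]
  rw [hlhs]
  calc Real.exp (2 * (j : ℝ) * Real.log (151 * (F.L : ℝ) ^ 2))
      ≤ Real.exp (Real.log (B10.pFun b₀ p₀ (Real.sqrt (γ * ((F.L : ℝ)⁻¹) ^ (K - j))))) := Real.exp_le_exp.mpr hlog
    _ = B10.pFun b₀ p₀ (Real.sqrt (γ * ((F.L : ℝ)⁻¹) ^ (K - j))) := Real.exp_log hp0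

end Reach

end Summit.QuantumFields.YangMills.Theorems.LargeFieldMassRefinementTailElementaryEnvelope

end
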